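import Summits.ABC.StewartYu.ArchG3RecLinesOAtomsB
import HarnessLib

/-!
# `ArchG3Rec` O-FAMILY letter lines — ATOMS C: the virtual denominator, the odd radius, the directional box, the jets radius and the box
# ceiling in the unit `Z`

Support file (theorems only; no named facts).  Cell `abc-stewartyu` (HOME `run/shared/lean/pub/abc-stewartyu/`), route `YuMatveevShapeRat`
(rung A1.L), crux r2 `ArchCoreRat` (stmt-ABC-20502), line `arch-g3-frame`, seam (B) of the last open stub `stub_recLinesArch`, plan R50
assignment «O (odd step): (J)+(C)+smallness → p2» (seat p2 g8).  Unit `Z = G·X·L`; p1's letter sheet `ArchG3RecLinesA–E`, p4's κ-twins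
`ArchG3RecLinesCK`; every helper of this family carries the suffix `O` (no collision with the other families' files).

* `cDR_le_ZO` — `cDR lev a x ≤ (7/10)·Z` for `a ≤ Tf 0 0`, `x ≤ 2Nh` (`(23/20)·Tf₀₀·H`, `6nL·Nh/2^lev`, p1's `SAR ≤ nL·WN/2^20`); `odd_radius_leO`;
* `dirbox_le_ZO` — `log(2·(2Nh)^{T+1}·T·(20e)^{2Nh·T}) ≤ (5/2)·Z`; `yB_factsO`;
* `T_log_CRK_le_ZO` — `T·log(2·CRK κ lev) ≤ Z/3` (sorted weights, p4's `log_CRK_le`: the `L` of `yRK` cancels against `T`);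
* `cb_parts_le_ZO` — `cbRK κ c lev m ≤ Z/10 − U0 c` for `m ≤ 2Nh`.

WHAT THIS IS NOT: any line of the family; no crux moves.

## References
* [Nesterenko2003] Yu. V. Nesterenko, LNM 1819 (2003) — §4.2 (4.24)–(4.35) with the odd nodes `𝒳_{s,0}`, p. 87–90; §3.5 (3.22)–(3.25),
  Lemma 3.10 (3.35), Lemma 3.11 (3.42), (3.37).
-/

noncomputable section

open Finset Real
open scoped Nat
open Summit.ABC.StewartYu.ArchSupply (WC)
open Summit.ABC.StewartYu.ArchG3Setup (DΔC)

namespace Summit.ABC.StewartYu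

namespace ArchG3Rec

open PadicG3Par (Cb Cb_pos)
open ArchG3Par (G K yloadK G_eq G_pos K_pos yloadK_pos)

variable {n : ℕ} (P : ArchG3Rec n)

/-- **the virtual denominator ceiling in `Z`**: for `a ≤ Tf 0 0` and `x ≤ 2·Nh lev`, `cDR lev a x ≤ (7/10)·Z`
(`(23/20)·Tf₀₀·H ≤ 0.3·Z`, `2x·Σ(LνRR/N)A ≤ 6nL·Nh/2^lev ≤ 3nXL + 6nL`, `2·SAR ≤ 2nL·WN/2^20`). [cite: Nesterenko2003, §3.5 Lemma 3.11 (3.42); shape only] -/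
theorem cDR_le_ZO (hn : 2 ≤ n) (lev : ℕ) {a : ℕ} (ha : a ≤ P.Tf 0 0) {x : ℝ} (hx : x ≤ 2 * P.Nh lev) :
    P.cDR lev a x ≤ 7 / 10 * P.Z := by
  obtain ⟨hZ, hL, hXL, hLW, hnXL, hG⟩ := P.currenciesO hn
  obtain ⟨hnL, -, -, -, -, -⟩ := P.letters_ZO hn
  obtain ⟨-, hNh, -, -⟩ := P.Nh_realO lev
  obtain ⟨hSj, hS, hS0⟩ := P.LνRR_A_le lev
  obtain ⟨-, -, hSAR⟩ := P.Amax_div_N_le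
  have hTH := P.Tf00_H_le_ZO hn
  have hH1 := P.H_lettersO.2.2
  have hn' : (2 : ℝ) ≤ n := by exact_mod_cast hn
  have hX := P.X_floors.2.1
  have hL1 := P.L_real.1
  have hWN := P.WN_bounds.1
  unfold cDR
  -- (1) `(23/20)·a·H ≤ (23/20)·Tf00·H`
  have ha' : (a : ℝ) ≤ P.Tf 0 0 := by exact_mod_cast ha
  have h1 : 23 / 20 * (a : ℝ) * P.H ≤ 23 / 20 * (33 / 128 * P.Z) := by
    have := mul_le_mul_of_nonneg_right ha' (by linarith only [hH1] : (0:ℝ) ≤ P.H)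
    linarith only [this, hTH]
  -- (2) `2x·Σ ≤ 4·Nh·(3/2)nL/2^lev ≤ 3nXL + 6nL`
  have h2 : 2 * x * ∑ j, (P.LνRR lev j : ℝ) / P.N * P.A j ≤ 3 / 8 * P.Z + 6 * (P.Z / 1536) := by
    have h2a : 2 * x * ∑ j, (P.LνRR lev j : ℝ) / P.N * P.A j ≤ 2 * (2 * P.Nh lev) * (3 / 2 * n * P.L / 2 ^ lev) := by
      have := mul_le_mul hx hS hS0 (by positivity : (0:ℝ) ≤ 2 * P.Nh lev)
      linarith only [this]
    have h2l : (0 : ℝ) < 2 ^ lev := by positivity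
    -- `Nh/2^lev ≤ X/2 + 1`
    have hq : (P.Nh lev : ℝ) / 2 ^ lev ≤ P.X / 2 + 1 := by
      rw [div_le_iff₀ h2l]
      have h1l : (1 : ℝ) ≤ 2 ^ lev := one_le_pow₀ (by norm_num)
      nlinarith only [hNh, h1l, hX]
    have e : 2 * (2 * (P.Nh lev : ℝ)) * (3 / 2 * n * P.L / 2 ^ lev) = 6 * (n * P.L) * ((P.Nh lev : ℝ) / 2 ^ lev) := by
      field_simp; ring
    have h2b := mul_le_mul_of_nonneg_left hq (by positivity : (0:ℝ) ≤ 6 * (n * P.L))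
    have h2c : (n : ℝ) * (P.X * P.L) ≤ ((n : ℝ) + 1) * (P.X * P.L) := by nlinarith only [hX, hL1]
    have h2d : (n : ℝ) * P.L ≤ ((n : ℝ) + 1) * P.L := by nlinarith only [hL1]
    have e2 : 6 * ((n : ℝ) * P.L) * (P.X / 2 + 1) = 3 * ((n : ℝ) * (P.X * P.L)) + 6 * ((n : ℝ) * P.L) := by ring
    linarith only [h2a, e, h2b, e2, h2c, h2d, hnXL, hnL]
  -- (3) `2·SAR ≤ 2nL·WN/2^20 ≤ Z/10^6`
  have h3 : 2 * P.SAR ≤ P.Z / 100000 := by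
    have h3a : (n : ℝ) * P.L * P.WN ≤ ((n : ℝ) + 1) * (P.L * P.WN) := by nlinarith only [hL1, hWN]
    have h3b := mul_le_mul_of_nonneg_left hLW (by positivity : (0:ℝ) ≤ (n : ℝ) + 1)
    have e : ((n : ℝ) + 1) * (P.Z / (64 * ((n : ℝ) + 1))) = P.Z / 64 := by field_simp
    rw [e] at h3b
    have : P.SAR ≤ (P.Z / 64) / 2 ^ 20 := by
      refine hSAR.trans ?_
      exact div_le_div_of_nonneg_right (h3a.trans h3b) (by positivity)
    have h64 : (P.Z / 64) / 2 ^ 20 ≤ P.Z / 200000 := by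
      rw [div_div, div_le_div_iff_of_pos_left hZ (by positivity) (by norm_num)]; norm_num
    linarith only [this, h64]
  linarith only [h1, h2, h3, hZ]

/-- the padded odd radius fits the Hasse-weight hypothesis: `2^{Ŝ−lev}·(6·Nh lev) ≤ 2^Ŝ·4X` (`lev ≤ Ŝ`). [folklore] -/
theorem odd_radius_leO (lev : ℕ) (hlevS : lev ≤ P.Sd) : (2 : ℝ) ^ (P.Sd - lev) * (6 * (P.Nh lev : ℝ)) ≤ 2 ^ P.Sd * (4 * P.X) := by
  obtain ⟨-, hNh, -, -⟩ := P.Nh_realO lev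
  have hX := P.X_floors.2.1
  have hpow : (2 : ℝ) ^ (P.Sd - lev) * 2 ^ lev = 2 ^ P.Sd := by rw [← pow_add, Nat.sub_add_cancel hlevS]
  have hle : (2 : ℝ) ^ (P.Sd - lev) ≤ 2 ^ P.Sd := pow_le_pow_right₀ (by norm_num) (Nat.sub_le _ _)
  have h0 : (0 : ℝ) ≤ 2 ^ (P.Sd - lev) := by positivity
  -- `6·Nh ≤ 3·2^lev·X + 6`
  have h1 : 6 * (P.Nh lev : ℝ) ≤ 3 * (2 ^ lev * P.X) + 6 := by linarith only [hNh]
  have h2 := mul_le_mul_of_nonneg_left h1 h0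
  have e : (2 : ℝ) ^ (P.Sd - lev) * (3 * (2 ^ lev * P.X) + 6) = 3 * (2 ^ (P.Sd - lev) * 2 ^ lev) * P.X + 6 * 2 ^ (P.Sd - lev) := by ring
  rw [e, hpow] at h2
  have h2S : (0 : ℝ) ≤ 2 ^ P.Sd := by positivity
  nlinarith only [h2, hle, hX, h2S]

/-- **the directional box of the odd step in `Z`** (`lev ≤ Ŝ`): `log(2·(2Nh)^{T+1}·T·(20e)^{2Nh·T}) ≤ (5/2)·Z`
(`(T+1)·log(2Nh) ≤ 9L·(10n + 30 + WN + X)`, `log T ≤ 8L`, `2Nh·T·log(20e) ≤ 8·(4XL + 8L)`). [cite: Nesterenko2003, §4.2 (4.24)–(4.29); shape only] -/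
theorem dirbox_le_ZO (hn : 2 ≤ n) (lev : ℕ) (hlevS : lev ≤ P.Sd) :
    Real.log (2 * ((2 * P.Nh lev : ℕ) : ℝ) ^ (P.T lev + 1) * P.T lev * (20 * Real.exp 1) ^ ((2 * P.Nh lev) * P.T lev)) ≤
      5 / 2 * P.Z := by
  obtain ⟨hZ, hL, hXL, hLW, hnXL, hG⟩ := P.currenciesO hn
  obtain ⟨hLZ, hXLZ, hXZ, hLWZ, hWNZ, hZ1⟩ := P.currenciesO' hn
  obtain ⟨hnL, -, -, -, -, -⟩ := P.letters_ZO hn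
  obtain ⟨hNh1, hNh, -, hcap⟩ := P.Nh_realO lev
  obtain ⟨hT1, hT8, -⟩ := P.T_realO lev
  obtain ⟨-, hSd2⟩ := P.Sd_log_le
  obtain ⟨hWN1, hWWN, hlogN, hWN0⟩ := P.WN_bounds
  have hX := P.X_floors.2.1
  have hL1 := P.L_real.1
  have hn' : (2 : ℝ) ≤ n := by exact_mod_cast hn
  have he := Real.exp_pos 1
  -- positivity of the four factors
  have hNhR : ((2 * P.Nh lev : ℕ) : ℝ) = 2 * (P.Nh lev : ℝ) := by push_cast; ring
  have hA0 : (0 : ℝ) < ((2 * P.Nh lev : ℕ) : ℝ) ^ (P.T lev + 1) := by rw [hNhR]; positivity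
  have hB0 : (0 : ℝ) < (P.T lev : ℝ) := by linarith only [hT1]
  have hC0 : (0 : ℝ) < (20 * Real.exp 1) ^ ((2 * P.Nh lev) * P.T lev) := by positivity
  rw [Real.log_mul (by positivity) hC0.ne', Real.log_mul (by positivity) hB0.ne', Real.log_mul (by norm_num) hA0.ne',
    Real.log_pow, Real.log_pow, hNhR]
  -- (1) `log(2Nh) ≤ Sd·log 2 + X + 1 ≤ 10n + 30 + WN + X`
  have h1 : Real.log (2 * (P.Nh lev : ℝ)) ≤ 10 * n + 30 + P.WN + P.X := by
    have h2l : (1 : ℝ) ≤ 2 ^ lev := one_le_pow₀ (by norm_num)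
    have hb : 2 * (P.Nh lev : ℝ) ≤ 2 ^ lev * (P.X + 2) := by nlinarith only [hNh, h2l]
    calc Real.log (2 * (P.Nh lev : ℝ)) ≤ Real.log (2 ^ lev * (P.X + 2)) := Real.log_le_log (by linarith only [hNh1]) hb
      _ = lev * Real.log 2 + Real.log (P.X + 2) := by rw [Real.log_mul (by positivity) (by linarith only [hX]), Real.log_pow]
      _ ≤ P.Sd * Real.log 2 + (P.X + 1) := by
          have hl : Real.log (P.X + 2) ≤ P.X + 1 := by
            have := Real.log_le_sub_one_of_pos (show (0:ℝ) < P.X + 2 by linarith only [hX]); linarith only [this]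
          have hlev : (lev : ℝ) * Real.log 2 ≤ P.Sd * Real.log 2 := by
            have : (lev : ℝ) ≤ P.Sd := by exact_mod_cast hlevS
            have hl2 := (Real.log_pos one_lt_two).le
            nlinarith only [this, hl2]
          linarith only [hl, hlev]
      _ ≤ 10 * n + 30 + P.WN + P.X := by linarith only [hSd2, hlogN]
  -- (2) `(T+1)·log(2Nh) ≤ 9L·(10n+30) + 9·L·WN + 9·X·L`
  have h2 : ((P.T lev + 1 : ℕ) : ℝ) * Real.log (2 * (P.Nh lev : ℝ)) ≤ 150 * (P.Z / 1536) + 9 * (P.Z / 192) + 9 * (P.Z / 24) := by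
    have hT9 : ((P.T lev + 1 : ℕ) : ℝ) ≤ 9 * P.L := by push_cast; linarith only [hT8, hL1]
    have hlog0 : 0 ≤ Real.log (2 * (P.Nh lev : ℝ)) := Real.log_nonneg (by linarith only [hNh1])
    have h2a := mul_le_mul hT9 h1 hlog0 (by positivity)
    have h2b : (10 : ℝ) * n + 30 ≤ 50 / 3 * ((n : ℝ) + 1) := by linarith only [hn']
    have h2c := mul_le_mul_of_nonneg_left h2b (by positivity : (0:ℝ) ≤ 9 * P.L)
    have e : 9 * (P.L : ℝ) * (10 * n + 30 + P.WN + P.X) = 9 * P.L * (10 * n + 30) + 9 * (P.L * P.WN) + 9 * (P.X * P.L) := by ring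
    have e2 : 9 * (P.L : ℝ) * (50 / 3 * ((n : ℝ) + 1)) = 150 * (((n : ℝ) + 1) * P.L) := by ring
    linarith only [h2a, h2c, e, e2, hnL, hLWZ, hXLZ]
  -- (3) `log T ≤ T ≤ 8L`
  have h3 : Real.log (P.T lev : ℝ) ≤ 8 * (P.Z / 4608) := by
    have := Real.log_le_sub_one_of_pos hB0; linarith only [this, hT8, hLZ]
  -- (4) `(2Nh·T)·log(20e) ≤ 2·(4XL + 8L)·4`
  have h4 : ((2 * P.Nh lev * P.T lev : ℕ) : ℝ) * Real.log (20 * Real.exp 1) ≤ 32 * (P.Z / 24) + 64 * (P.Z / 4608) := by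
    have hl20 : Real.log (20 * Real.exp 1) ≤ 4 := by
      rw [Real.log_mul (by norm_num) he.ne', Real.log_exp]; linarith only [log_twenty_le_threeO]
    have hl0 : 0 ≤ Real.log (20 * Real.exp 1) := by
      rw [Real.log_mul (by norm_num) he.ne', Real.log_exp]; have := Real.log_nonneg (show (1:ℝ) ≤ 20 by norm_num); linarith only [this]
    have hNT : ((2 * P.Nh lev * P.T lev : ℕ) : ℝ) ≤ 2 * (4 * P.X * P.L + 8 * P.L) := by
      push_cast
      -- `Nh·T ≤ Nh·(T+1) − Nh ≤ 4XL + T + 1 − 1 ≤ 4XL + 8L`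
      nlinarith only [hcap, hNh1, hT8, hT1]
    have := mul_le_mul hNT hl20 hl0 (by positivity)
    linarith only [this, hXLZ, hLZ]
  have hl2 : Real.log 2 ≤ 1 := by have := Real.log_two_lt_d9; linarith
  -- cast bookkeeping: `↑(T+1)` and `↑(2Nh·T)` as they appear after `Real.log_pow`
  have eT : ((P.T lev + 1 : ℕ) : ℝ) = (P.T lev : ℝ) + 1 := by push_cast; ring
  have eNT : ((2 * P.Nh lev * P.T lev : ℕ) : ℝ) = ((2 * P.Nh lev * P.T lev : ℕ) : ℝ) := rfl
  rw [eT] at h2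
  push_cast at h4 ⊢
  linarith only [hl2, h2, h3, h4, hZ1, hZ]

/-- `1 ≤ 10n·(κn)` and `log(10n·(κn)) ≤ 4n + 8` for `κ ≥ 1`, `log κ ≤ n·log 2` (the `yB` of p4's `YRK_le`). [folklore] -/
theorem yB_factsO (hn : 2 ≤ n) {κ : ℕ} (hκ : 1 ≤ κ) (hlκ : Real.log κ ≤ n * Real.log 2) :
    (1 : ℝ) ≤ 10 * n * (κ * n) ∧ Real.log (10 * n * ((κ : ℝ) * n)) ≤ 4 * n + 8 := by
  have hn' : (2 : ℝ) ≤ n := by exact_mod_cast hn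
  have hκ' : (1 : ℝ) ≤ κ := by exact_mod_cast hκ
  have hκn : (1 : ℝ) ≤ (κ : ℝ) * n := by nlinarith only [hκ', hn']
  refine ⟨by nlinarith only [hκn, hn'], ?_⟩
  have hl2 : Real.log 2 ≤ 1 := by have := Real.log_two_lt_d9; linarith
  have hlogn : Real.log (n : ℝ) ≤ (n : ℝ) - 1 := Real.log_le_sub_one_of_pos (by linarith only [hn'])
  rw [Real.log_mul (by positivity) (by positivity), Real.log_mul (by norm_num) (by positivity),
    Real.log_mul (by positivity) (by positivity)]
  have hn0 : (0:ℝ) ≤ n := by linarith only [hn']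
  nlinarith only [log_ten_le_threeO, hlogn, hlκ, hl2, hn0]

/-- **`T·log(2·CRK)` in `Z`** (sorted weights, `lev ≤ Ŝ`, `κ ≥ 1`, `log κ ≤ n log 2`): `T lev·log(2·CRK κ lev) ≤ Z/3`
(p4's `log_CRK_le`: the `L` of `yRK` cancels against `T`; `log(2·CRK) ≤ 32 + 14n + 3·WN`). [cite: Nesterenko2003, §4.2 Lemma 4.3 (4.22); shape only] -/
theorem T_log_CRK_le_ZO (hn : 2 ≤ n) {κ : ℕ} (hκ : 1 ≤ κ) (hlκ : Real.log κ ≤ n * Real.log 2) (hmono : Monotone P.A)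
    (lev : ℕ) (hlevS : lev ≤ P.Sd) : (P.T lev : ℝ) * Real.log (2 * P.CRK κ lev) ≤ P.Z / 3 := by
  obtain ⟨hC1, hC⟩ := P.log_CRK_le κ hκ hmono lev
  obtain ⟨hLZ, hXLZ, hXZ, hLWZ, hWNZ, hZ1⟩ := P.currenciesO' hn
  obtain ⟨hnL, -, -, -, -, -⟩ := P.letters_ZO hn
  obtain ⟨hT1, hT8, -⟩ := P.T_realO lev
  obtain ⟨-, hSd2⟩ := P.Sd_log_le
  obtain ⟨hWN1, hWWN, hlogN, hWN0⟩ := P.WN_bounds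
  have hB1 := P.Alast_facts.2.2.2.2.2
  have hN := P.N_facts
  have hL1 := P.L_real.1
  have hn' : (2 : ℝ) ≤ n := by exact_mod_cast hn
  have hκ' : (1 : ℝ) ≤ κ := by exact_mod_cast hκ
  have hl2 : Real.log 2 ≤ 1 := by have := Real.log_two_lt_d9; linarith
  have hl2p : 0 < Real.log 2 := Real.log_pos one_lt_two
  -- `u := (7/2)n²(κn)·B·N²·2^lev ≥ 1`, `log(1+u) ≤ log(2u)`
  set u : ℝ := 7 / 2 * n ^ 2 * (κ * n) * P.Bexp * P.N ^ 2 * 2 ^ lev with hu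
  have hN2 : (1 : ℝ) ≤ P.N ^ 2 := one_le_pow₀ hN.2.1
  have h2l : (1 : ℝ) ≤ 2 ^ lev := one_le_pow₀ (by norm_num)
  have hu1 : 1 ≤ u := by
    rw [hu]
    have h72 : (1 : ℝ) ≤ 7 / 2 * n ^ 2 := by nlinarith only [hn']
    have hκn : (1 : ℝ) ≤ (κ : ℝ) * n := by nlinarith only [hκ', hn']
    calc (1 : ℝ) = 1 * 1 * 1 * 1 * 1 := by ring
      _ ≤ 7 / 2 * n ^ 2 * (κ * n) * P.Bexp * P.N ^ 2 * 2 ^ lev := by gcongr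
  have hu0 : 0 < u := by linarith only [hu1]
  have hlogu : Real.log (1 + u) ≤ Real.log 2 + Real.log u := by
    rw [← Real.log_mul (by norm_num) hu0.ne']
    exact Real.log_le_log (by linarith only [hu0]) (by linarith only [hu1])
  have hlogu' : Real.log u = Real.log (7 / 2) + 2 * Real.log n + (Real.log κ + Real.log n) + Real.log P.Bexp + 2 * Real.log P.N +
      lev * Real.log 2 := by
    rw [hu]
    have hn0 : (0:ℝ) < n := by linarith only [hn']
    have hκ0 : (0:ℝ) < κ := by linarith only [hκ']
    rw [Real.log_mul (by positivity) (by positivity), Real.log_mul (by positivity) (by positivity),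
      Real.log_mul (by positivity) (by linarith only [hB1]), Real.log_mul (by positivity) (by positivity),
      Real.log_mul (by norm_num) (by positivity), Real.log_pow, Real.log_mul hκ0.ne' hn0.ne', Real.log_pow, Real.log_pow]
    push_cast; ring
  have hlog72 : Real.log (7 / 2) ≤ 2 := by
    have h6 : Real.log 6 ≤ 2 := by
      have he := Real.exp_one_gt_d9
      have e2 : Real.exp 1 ^ 2 = Real.exp 2 := by rw [Real.exp_one_pow]; norm_num
      have hp : (2.7182818283 : ℝ) ^ 2 ≤ Real.exp 1 ^ 2 := pow_le_pow_left₀ (by norm_num) he.le 2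
      have hc : (6 : ℝ) ≤ (2.7182818283 : ℝ) ^ 2 := by norm_num
      calc Real.log 6 ≤ Real.log (Real.exp 2) := Real.log_le_log (by norm_num) (by rw [← e2]; linarith)
        _ = 2 := Real.log_exp 2
    exact (Real.log_le_log (by norm_num) (by norm_num : (7 / 2 : ℝ) ≤ 6)).trans h6
  have hlogn : Real.log (n : ℝ) ≤ (n : ℝ) - 1 := Real.log_le_sub_one_of_pos (by linarith only [hn'])
  have hB : Real.log P.Bexp = P.W - 1 := by unfold Bexp; exact Real.log_exp _
  have hlev : (lev : ℝ) * Real.log 2 ≤ 10 * n + 29 + P.WN := by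
    have : (lev : ℝ) ≤ P.Sd := by exact_mod_cast hlevS
    nlinarith only [this, hl2p.le, hSd2, hlogN]
  have hWNdef : P.WN = P.W + Real.log P.N := rfl
  -- `log(2·CRK) ≤ 32 + 14n + 3·WN`
  have hmain : Real.log (2 * P.CRK κ lev) ≤ 32 + 14 * n + 3 * P.WN := by
    have hn0 : (0:ℝ) ≤ n := by linarith only [hn']
    nlinarith only [hC, hlogu, hlogu', hlog72, hlogn, hlκ, hB, hlev, hWNdef, hlogN, hl2, hn0]
  have hT0 : (0 : ℝ) ≤ P.T lev := by linarith only [hT1]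
  have h1 := mul_le_mul_of_nonneg_left hmain hT0
  -- `T·(32 + 14n) ≤ 8L·14·(n + 16/7) ≤ 112·(11/7)... use 32 + 14n ≤ 20(n+1)` for `n ≥ 2`
  have h2 : (32 : ℝ) + 14 * n ≤ 20 * ((n : ℝ) + 1) := by linarith only [hn']
  have h3 : (P.T lev : ℝ) * (32 + 14 * n) ≤ 160 * (((n : ℝ) + 1) * P.L) := by
    have := mul_le_mul hT8 h2 (by positivity) (by positivity)
    linarith only [this]
  have h4 : (P.T lev : ℝ) * (3 * P.WN) ≤ 24 * (P.L * P.WN) := by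
    have := mul_le_mul_of_nonneg_right hT8 (by positivity : (0:ℝ) ≤ 3 * P.WN)
    linarith only [this]
  have e : (P.T lev : ℝ) * (32 + 14 * n + 3 * P.WN) = (P.T lev : ℝ) * (32 + 14 * n) + P.T lev * (3 * P.WN) := by ring
  linarith only [h1, e, h3, h4, hnL, hLWZ, hZ1]

/-- the box-ceiling parts: for `(m : ℝ) ≤ 2·Nh lev` (`lev ≤ Ŝ`), `log 2 + log(LbRK κ lev jl + 1) + log(m + 1) ≤ Z/10` (so `cbRK κ c lev m ≤ Z/10 − U0 c`).
[folklore] -/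
theorem cb_parts_le_ZO (hn : 2 ≤ n) (κ lev : ℕ) (hlevS : lev ≤ P.Sd) {m : ℕ} (hm : (m : ℝ) ≤ 2 * P.Nh lev) (c : ℝ) :
    P.cbRK κ c lev m ≤ P.Z / 10 - P.U0 c := by
  obtain ⟨hlogLb, -, hlog2Nh⟩ := P.log_box_range_leO κ lev hlevS
  obtain ⟨hLZ, hXLZ, hXZ, hLWZ, hWNZ, hZ1⟩ := P.currenciesO' hn
  obtain ⟨hc1, -, -, hl2, -⟩ := P.constsO hn
  obtain ⟨-, hSd2⟩ := P.Sd_log_le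
  obtain ⟨hNh1, -, -, -⟩ := P.Nh_realO lev
  have hlogN := P.WN_bounds.2.2.1
  have hL1 := P.L_real.1
  unfold cbRK
  have hm1 : Real.log ((m : ℝ) + 1) ≤ Real.log (2 * (P.Nh lev : ℝ) + 1) :=
    Real.log_le_log (by positivity) (by linarith only [hm])
  have hdiv : (P.L : ℝ) / 2 ^ 21 ≤ P.L := div_le_self (by linarith only [hL1]) (one_le_pow₀ (by norm_num))
  linarith only [hl2, hlogLb, hm1, hlog2Nh, hSd2, hlogN, hdiv, hLZ, hXZ, hWNZ, hc1]

end ArchG3Rec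

end Summit.ABC.StewartYu

end
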